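import Literature.NumberTheory.Automorphic.LocalUnitaryIntegralLevelCongr                       -- ★ `exists_localFormCongr_levelMatching_of_smul_eq` (the level-matching stub frame `T₀`)
import Summits.HodgeConjecture.HodgeConjecture.Theorems.R90S6FrameMemLawUnitaryInt               -- ★ W9-A′ (F.2) `exists_continuousMulEquiv_memLaw_unitaryInt_cm_antidiagOne`
import Summits.HodgeConjecture.HodgeConjecture.Theorems.R90S6HeckeCoeffIndepCMTwo                -- ★ W9-A.6 `coeff_toVector_comp_eq_of_memLaw_cm_two` («EH-SWAP»)
import Summits.HodgeConjecture.HodgeConjecture.Theorems.F0P3cCMLocalNonsplitBorelTransportU2     -- ★ `localNonsplitEquiv_mem_unipotentU_iff₂` (N = 2 radical law)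
import Literature.NumberTheory.Automorphic.CMLocalNonsplitBorelTransport                         -- ★ `localNonsplitEquiv_mem_unipotentU_iff` (N = 3 radical law)
import Literature.NumberTheory.Rogawski1990.FinExplicitTransferFactorLeviStratum                 -- ★ `endoEmbLocal_eq_glDiagonal_of_fst_eq` (Levi-stratum letters `d'`, `finGammaTwo`)
import Literature.NumberTheory.Rogawski1990.UnitFundamentalLemmaExplicitNonsplitClosedProof      -- ★ `eventually_forall_placesOver_nonsplitGood`, ★ `eventually_forall_placesOver_isUnit_two`
import HarnessLib

/-!
# R90 · S6 «Ch. 14.1–14.5 stable trace formula» — (G4) THE SOCKET FRAME DOSSIER for `StubR90ExtE1HeckeFLOneFrame`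
# (`Theorems/R90S6SocketFrameDossier.lean`; DAG r26 row E1.3.3.4 «frame ∕ level transport», glue «FRAME RECIPE» + «SBAD-FIN» + «EH-SWAP»)

Cell `hodgecm-mathlib`, crux H413 (`stmt-HodgeConjecture-24833`), route of record `HCCMUnconditional`; programme R90-TF, section S6 (base `R90-C14`),
seat K2E3-p11 (g11) (S6 dealer R90-C14-plan (g2) standing offer (G4), R90 bus 2026-09-05T02:51:28Z; typ2 (g3) T2-ASM census
`R90/R90-C14-typ2/g3/S6_E139_AssemblyCensus.v1.md` 15fbf54ecafd8538 §2 FRAME RECIPE ∕ §3 row E1.3.3.4).  Lane `--kind proof --supports stmt-HodgeConjecture-24833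
--as helper`; THEOREMS ONLY (no definition, no instance, no notation, no named fact, no `sorry`; default heartbeats); imports ★ Literature ∕ ★ Theorems only
(never `Lines/`).

## What the (G5) assembler of `StubR90ExtE1HeckeFLOneFrame` (`Cruxes/H413/Lines/R90_S6_FloorE1D.lean` :989) chooses, and what the ★ payers consume

The assembler chooses `Sbad` and the `G`-frame `eG`, then faces an ADVERSARIAL `H`-frame `eH`; the ★ hyperbolic payer (B2d) CLOSED p864596 consumes `hH'w hH'i hμ`, a STUB
FRAME `congr := cmDatumLocalCongr L v T₀ ha₀ hT₀`, for `eG ∘ congr` the letters `hN hEK EN hEN hνG1 hEt`, and `hN₂ hEK₂ EN₂ hEN₂ hEHt` on the `H`-side.  ALL supplied here: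
* §1 «SBAD-FIN» `eventually_placesOver_good` ∕ `exists_finset_placesOver_good` — off ONE finite `Sbad` every `w ∣ v` has `H′_w ∈ GL₃(𝒪_w)`, `μ` unramified at `w`, `2 ∈ 𝒪_w^×`.
* §2 «FRAME RECIPE, G-side» `exists_socketFrame_three` — a LEVEL-MATCHING stub frame with `T₀` componentwise integral (★ `exists_localFormCongr_levelMatching_of_smul_eq`:
  Jacobowitz's integral hyperbolic basis regrouped over `L ⊗ L⁺_v`), the one-place frame `e₀³` of ★ W9-A′ (F.2), and THE SOCKET FRAME `eG := congr.symm.trans e₀³`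
  with the matrix law `(eG (congr g))_w = g_w`, the socket's K-law, (B2d)'s `hEK`; `unipotent_law_of_matrixLaw` — `hN` + `EN` + `hEN` from the matrix law alone.
* §3 `preimage_congr_symm_level_eq`, `measure_preimage_congr_symm_eq_one` — `hνG1`; §4 `coe_frame_congr_endoEmbLocal_eq_diagonal` — the torus entry law `hEt`.
* §5 «FRAME RECIPE, H-side» `exists_socketFrame_two` (the LITERAL frame `e₀²` of ★ (F.2) with the socket's K-law₂), `unipotent_law_two_of_matrixLaw` (`hN₂ EN₂ hEN₂`),
  `coe_frame_two_eq_diagonal` (`hEHt`).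
* §6 «EH-SWAP» `heckeTestFun_eq_of_memLaw_two` — for ANY two K-law₂ frames the socket's `H`-test function `h ↦ (T₂[K₀] φH).coeff ↑(eH h.1)` is the same function
  (★ W9-A.6) — the assembler rewrites the adversarial `eH` into the literal `e₀²` of §5 before every cell payer.
NOT here (separate brick): «CLASSIFY» (a `G`-regular `γ_H` is `H_v`-conjugate to a literal HYP ∕ ELL-1 ∕ ELL-2 representative).  HONEST LABEL: helper theorems, count-neutral until the E1.3.9 assembly consumes them; HC_CM is proved only modulo the 7 printed citations (2 remaining named inputs:
hLiu418 = stmt-HodgeConjecture-24832, h413 = stmt-HodgeConjecture-24833) until rung 0 closes; REL ≠ ★ ≠ BUILT.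

## References
* [Rogawski1990] J. D. Rogawski, *Automorphic Representations of Unitary Groups in Three Variables* (1990), §14.2 p. 233; §4.9 pp. 54–56; §4.3 p. 43; §14.6 p. 242.
* [Jacobowitz1962] R. Jacobowitz, *Hermitian forms over local fields*, Amer. J. Math. 84 (1962), §7 Thm. 7.1.
* [PlatonovRapinchuk1994] V. Platonov, A. Rapinchuk, *Algebraic Groups and Number Theory* (1994), §2.3, §5.1.
* [CartierCorvallis1979] P. Cartier, *Representations of p-adic groups: a survey*, PSPM 33.1 (1979), §IV.1. -/

set_option autoImplicit false
set_option linter.dupNamespace false  -- the mandated namespace repeats the single-problem summit's segment (`HodgeConjecture.HodgeConjecture`)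

noncomputable section

open MeasureTheory Measure Set NumberField IsDedekindDomain Matrix Filter
open Literature.NumberTheory.Automorphic Literature.NumberTheory.Automorphic.UnitaryGroup
open Literature.NumberTheory.Automorphic.HermitianLattice
open Literature.NumberTheory.GaloisRepresentations
open Literature.NumberTheory.Rogawski1990
open scoped NNReal ENNReal Matrix MatrixGroups Valued WithZero

namespace Summit.HodgeConjecture.HodgeConjecture.R90.S6

variable (L : Type) [Field L] [NumberField L] [IsCMField L]

/-! ## §1 «SBAD-FIN»: one finite exceptional set for the good-reduction guards -/

section Sbad

/-- **«SBAD-FIN», cofinite shape.**  For `H′ ∈ M₃(L)` anisotropic (so `H′ ∈ GL₃(L)`) and a Hecke character `μ` of `L`, for all but finitely many finite places `v` of `L⁺`,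
every `w ∣ v` has: `H′_w ∈ GL₃(𝒪_w)` (the `hH'w hH'i` letters of the ★ (B2d) payer), `μ` unramified at `w` (`hμ`), and `2 ∈ 𝒪_w^×` (Flicker's standing `p ≠ 2` of the (E1)∕(E2)
record sheets; Mathlib's `ValuativeRel` integers, as ★ G3-NUMBERS).  (★ `eventually_forall_placesOver_nonsplitGood` ∧ ★ `eventually_forall_placesOver_isUnit_two`.)
[cite: Rogawski1990, §14.6 p. 242; §4.9 Prop. 4.9.1 (b) p. 55] [cite: PlatonovRapinchuk1994, §5.1] -/
theorem eventually_placesOver_good (H' : Matrix (Fin 3) (Fin 3) L)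
    (hanis : ∀ x : Fin 3 → L, Literature.AlgebraicGeometry.ShimuraVarieties.hermForm (cmConjRingHom L) H' x x = 0 → x = 0) (μ : HeckeCharacter L) :
    ∀ᶠ v : HeightOneSpectrum (𝓞 ↥(maximalRealSubfield L)) in cofinite, ∀ w : PlacesOver L v,
      (∃ hH'w : IsUnit (placeForm H' w.1), hH'w.unit ∈ glInt 3 (w.1.adicCompletion L)) ∧ μ.IsUnramifiedAt w.1 ∧
        IsUnit (2 : ↥(ValuativeRel.valuation (w.1.adicCompletion L)).integer) := by
  have hdet : H'.det ≠ 0 := by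
    intro hdet
    obtain ⟨x, hx, hHx⟩ := Matrix.exists_mulVec_eq_zero_iff.mpr hdet
    refine hx (hanis x ?_)
    rw [Literature.AlgebraicGeometry.ShimuraVarieties.hermForm, hHx, dotProduct_zero]
  have hH'u : IsUnit H' := (Matrix.isUnit_iff_isUnit_det H').2 (isUnit_iff_ne_zero.2 hdet)
  filter_upwards [eventually_forall_placesOver_nonsplitGood L H' μ hH'u, eventually_forall_placesOver_isUnit_two L] with v hv h2 w
  exact ⟨⟨isUnit_placeForm H' hH'u w.1, (hv w).2.1⟩, (hv w).2.2, h2 w⟩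

/-- **«SBAD-FIN», socket shape (`∃ Sbad : Finset, ∀ v ∉ Sbad, …`)** — the exceptional set of the one-frame socket is ONE finite set. [cite: Rogawski1990, §14.6 p. 242] -/
theorem exists_finset_placesOver_good (H' : Matrix (Fin 3) (Fin 3) L)
    (hanis : ∀ x : Fin 3 → L, Literature.AlgebraicGeometry.ShimuraVarieties.hermForm (cmConjRingHom L) H' x x = 0 → x = 0) (μ : HeckeCharacter L) :
    ∃ Sbad : Finset (HeightOneSpectrum (𝓞 ↥(maximalRealSubfield L))),
      ∀ v : HeightOneSpectrum (𝓞 ↥(maximalRealSubfield L)), v ∉ Sbad → ∀ w : PlacesOver L v,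
        (∃ hH'w : IsUnit (placeForm H' w.1), hH'w.unit ∈ glInt 3 (w.1.adicCompletion L)) ∧ μ.IsUnramifiedAt w.1 ∧
          IsUnit (2 : ↥(ValuativeRel.valuation (w.1.adicCompletion L)).integer) := by
  have hev := Filter.eventually_cofinite.1 (eventually_placesOver_good L H' hanis μ)
  refine ⟨hev.toFinset, fun v hv => ?_⟩
  have hv' := mt hev.mem_toFinset.2 hv
  rwa [Set.mem_setOf_eq, not_not] at hv'

end Sbad

/-! ## §2 «FRAME RECIPE», `G`-side: the level-matching stub frame `congr`, the one-place frame `e₀³`, the socket frame `eG := congr.symm.trans e₀³` -/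

section GFrame

/-- **(G4) THE SOCKET FRAME AT `N = 3`.**  At a finite place `v` of `L⁺` non-split (`c • w = w`) and unramified in `L`, for `H′` hermitian with `H′_w ∈ GL₃(𝒪_w)`: there are a
similitude `T₀ ∈ GL₃(L ⊗ L⁺_v)` onto `a₀ • Φ₃` (`hT₀`, the datum of the stub frame `congr := cmDatumLocalCongr L v T₀ ha₀ hT₀ : U(Φ₃)(L⁺_v) ≃ₜ* U(H′)(L⁺_v)`) and an
isomorphism of topological groups `eG : U(H′)(L⁺_v) ≃ₜ* U(σ_w, J₀)(L_w)` (`J₀ = antidiag(1,1,1)`) such that: (T-INT) `T₀` is componentwise integral; (LEV)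
`congr.symm g ∈ U(Φ₃)(𝒪_v) ↔ g ∈ U(H′)(𝒪_v)`; (MAT) `(eG (congr g))_w = g_w` (the one-place model ★ `localNonsplitEquiv`, matrices read entrywise at `w`); (K-SOC) the socket's
K-law `eG g ∈ U(J₀)(𝒪_w) ↔ g ∈ U(H′)(𝒪_v)` (token for token the binder :1044–:1046 of `StubR90ExtE1HeckeFLOneFrame`); (hEK) `eG (congr g) ∈ U(J₀)(𝒪_w) ↔ g ∈ U(Φ₃)(𝒪_v)`
(the ★ (B2d) letter).  CONSTRUCTION: `T₀` = Jacobowitz's integral hyperbolic basis regrouped over `L ⊗ L⁺_v` (★ `exists_localFormCongr_levelMatching_of_smul_eq`), `e₀³` = ★ W9-A′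
(F.2), `eG := congr.symm.trans e₀³`.  The radical letters `hN EN hEN` and the torus entry law `hEt` follow from (MAT) alone (`unipotent_law_of_matrixLaw`,
`coe_frame_congr_endoEmbLocal_eq_diagonal`). [cite: Rogawski1990, §14.2 p. 233; §4.9 p. 54] [cite: Jacobowitz1962, §7 Thm. 7.1] [cite: PlatonovRapinchuk1994, §2.3, §5.1] -/
theorem exists_socketFrame_three (H' : Matrix (Fin 3) (Fin 3) L) (hH' : (H'.map (IsCMField.complexConj L))ᵀ = H')
    {v : HeightOneSpectrum (𝓞 ↥(maximalRealSubfield L))} (w : PlacesOver L v) (hw : IsCMField.complexConj L • w.1 = w.1)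
    (hv : Algebra.IsUnramifiedIn (𝓞 L) v.asIdeal) (hH'w : IsUnit (placeForm H' w.1)) (hH'i : hH'w.unit ∈ glInt 3 (w.1.adicCompletion L)) :
    ∃ (T₀ : GL (Fin 3) (LocalRing L v)) (a₀ : LocalRing L v) (ha₀ : IsUnit a₀)
      (hT₀ : formCongr (conjLocal L (IsCMField.complexConj L) v) T₀ (H'.map (algebraMap L (LocalRing L v))) =
        a₀ • (Matrix.of fun i j : Fin 3 => if i.val + j.val + 1 = 3 then (1 : L) else 0).map (algebraMap L (LocalRing L v)))
      (eG : (cmDatum L 3 H').Local v ≃ₜ*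
        ↥(unitaryGroupOfForm (galAdicCompletionMap (L := L) (IsCMField.complexConj L) hw) ((StdForm.antidiagonal 3).over (w.1.adicCompletion L)))),
      -- (T-INT)
      (∀ w' : PlacesOver L v, localGLPiEquiv L 3 v T₀ w' ∈ glInt 3 (w'.1.adicCompletion L)) ∧
      -- (LEV)
      (∀ g : (cmDatum L 3 H').Local v,
        (cmDatumLocalCongr L v T₀ ha₀ hT₀).symm g ∈
            cmLocalIntegralLevel L 3 (Matrix.of fun i j : Fin 3 => if i.val + j.val + 1 = 3 then (1 : L) else 0) v ↔
          g ∈ cmLocalIntegralLevel L 3 H' v) ∧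
      -- (MAT)
      (∀ g : ↥(unitaryGroupOfForm (conjLocal L (IsCMField.complexConj L) v) (cmLocalForm L 3 v)),
        ((eG (cmDatumLocalCongr L v T₀ ha₀ hT₀ g) :
            ↥(unitaryGroupOfForm (galAdicCompletionMap (L := L) (IsCMField.complexConj L) hw) ((StdForm.antidiagonal 3).over (w.1.adicCompletion L)))) :
              GL (Fin 3) (w.1.adicCompletion L)) =
          ((localNonsplitEquiv (IsCMField.complexConj L) (Matrix.of fun i j : Fin 3 => if i.val + j.val + 1 = 3 then (1 : L) else 0)
              (IsCMField.complexConj_ne_one L) w hw g).val : GL (Fin 3) (w.1.adicCompletion L))) ∧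
      -- (K-SOC)
      (∀ g : (cmDatum L 3 H').Local v,
        eG g ∈ unitaryInt (galAdicCompletionMap (L := L) (IsCMField.complexConj L) hw) ((StdForm.antidiagonal 3).over (w.1.adicCompletion L)) ↔
          g ∈ cmLocalIntegralLevel L 3 H' v) ∧
      -- (hEK)
      (∀ g : ↥(unitaryGroupOfForm (conjLocal L (IsCMField.complexConj L) v) (cmLocalForm L 3 v)),
        eG (cmDatumLocalCongr L v T₀ ha₀ hT₀ g) ∈
            unitaryInt (galAdicCompletionMap (L := L) (IsCMField.complexConj L) hw) ((StdForm.antidiagonal 3).over (w.1.adicCompletion L)) ↔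
          g ∈ cmLocalIntegralLevel L 3 (Matrix.of fun i j : Fin 3 => if i.val + j.val + 1 = 3 then (1 : L) else 0) v) := by
  haveI : Algebra.IsQuadraticExtension ↥(maximalRealSubfield L) L := IsCMField.isQuadraticExtension L
  obtain ⟨T₀, a₀, ha₀, hT₀, hTint, hlev⟩ :=
    exists_localFormCongr_levelMatching_of_smul_eq (IsCMField.complexConj L) (IsCMField.complexConj_ne_one L) hH' w hw hv hH'w hH'i
  obtain ⟨e₀, he₀, hK₀⟩ := exists_continuousMulEquiv_memLaw_unitaryInt_cm_antidiagOne L 3 w hw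
  -- `eG := congr.symm.trans e₀³`, so that `eG (congr x) = e₀³ x`
  have htrans : ∀ x : ↥(unitaryGroupOfForm (conjLocal L (IsCMField.complexConj L) v) (cmLocalForm L 3 v)),
      ((cmDatumLocalCongr L v T₀ ha₀ hT₀).symm.trans e₀) (cmDatumLocalCongr L v T₀ ha₀ hT₀ x) = e₀ x := fun x => by
    rw [ContinuousMulEquiv.trans_apply, ContinuousMulEquiv.symm_apply_apply]
  refine ⟨T₀, a₀, ha₀, hT₀, (cmDatumLocalCongr L v T₀ ha₀ hT₀).symm.trans e₀, hTint, hlev,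
    fun g => (htrans g).symm ▸ he₀ g, fun g => ?_, fun g => (htrans g).symm ▸ hK₀ g⟩
  -- (K-SOC)
  rw [ContinuousMulEquiv.trans_apply, hK₀]
  exact hlev g

/-- **THE RADICAL LETTERS `hN`, `EN`, `hEN` OF THE ★ (B2d) PAYER FROM THE MATRIX LAW.**  For any stub frame `congr = cmDatumLocalCongr L v T₀ ha₀ hT₀` and any `eG` with
(MAT) `(eG (congr g))_w = g_w`: `g ∈ N(Φ₃)(L⁺_v) ↔ eG (congr g) ∈ N(J₀)(L_w)` (upper unitriangular on both sides, read entrywise at the unique place `w`: ★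
`localNonsplitEquiv_mem_unipotentU_iff` + ★ `mem_unipotentU_iff`), and the radical transport `EN : N(Φ₃)_v ≃ₜ* N(J₀)_w`, `↑(EN n) = eG (congr n)`
(★ `ContinuousMulEquiv.restrictSubgroup`). [cite: Rogawski1990, §1.10 p. 9; §4.9 p. 55] [cite: PlatonovRapinchuk1994, §5.1] -/
theorem unipotent_law_of_matrixLaw {H' : Matrix (Fin 3) (Fin 3) L} {v : HeightOneSpectrum (𝓞 ↥(maximalRealSubfield L))}
    (w : PlacesOver L v) (hw : IsCMField.complexConj L • w.1 = w.1)
    (T₀ : GL (Fin 3) (LocalRing L v)) {a₀ : LocalRing L v} (ha₀ : IsUnit a₀)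
    (hT₀ : formCongr (conjLocal L (IsCMField.complexConj L) v) T₀ (H'.map (algebraMap L (LocalRing L v))) =
      a₀ • (Matrix.of fun i j : Fin 3 => if i.val + j.val + 1 = 3 then (1 : L) else 0).map (algebraMap L (LocalRing L v)))
    (eG : (cmDatum L 3 H').Local v ≃ₜ*
      ↥(unitaryGroupOfForm (galAdicCompletionMap (L := L) (IsCMField.complexConj L) hw) ((StdForm.antidiagonal 3).over (w.1.adicCompletion L))))
    (hmat : ∀ g : ↥(unitaryGroupOfForm (conjLocal L (IsCMField.complexConj L) v) (cmLocalForm L 3 v)),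
      ((eG (cmDatumLocalCongr L v T₀ ha₀ hT₀ g) :
          ↥(unitaryGroupOfForm (galAdicCompletionMap (L := L) (IsCMField.complexConj L) hw) ((StdForm.antidiagonal 3).over (w.1.adicCompletion L)))) :
            GL (Fin 3) (w.1.adicCompletion L)) =
        ((localNonsplitEquiv (IsCMField.complexConj L) (Matrix.of fun i j : Fin 3 => if i.val + j.val + 1 = 3 then (1 : L) else 0)
            (IsCMField.complexConj_ne_one L) w hw g).val : GL (Fin 3) (w.1.adicCompletion L))) :
    (∀ g : ↥(unitaryGroupOfForm (conjLocal L (IsCMField.complexConj L) v) (cmLocalForm L 3 v)),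
        g ∈ unipotentU (conjLocal L (IsCMField.complexConj L) v) (cmLocalForm L 3 v) ↔
          eG (cmDatumLocalCongr L v T₀ ha₀ hT₀ g) ∈
            unipotentU (galAdicCompletionMap (L := L) (IsCMField.complexConj L) hw) ((StdForm.antidiagonal 3).over (w.1.adicCompletion L))) ∧
      ∃ EN : ↥(unipotentU (conjLocal L (IsCMField.complexConj L) v) (cmLocalForm L 3 v)) ≃ₜ*
          ↥(unipotentU (galAdicCompletionMap (L := L) (IsCMField.complexConj L) hw) ((StdForm.antidiagonal 3).over (w.1.adicCompletion L))),
        ∀ n : ↥(unipotentU (conjLocal L (IsCMField.complexConj L) v) (cmLocalForm L 3 v)),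
          ((EN n : ↥(unipotentU (galAdicCompletionMap (L := L) (IsCMField.complexConj L) hw) ((StdForm.antidiagonal 3).over (w.1.adicCompletion L)))) :
              ↥(unitaryGroupOfForm (galAdicCompletionMap (L := L) (IsCMField.complexConj L) hw) ((StdForm.antidiagonal 3).over (w.1.adicCompletion L)))) =
            eG (cmDatumLocalCongr L v T₀ ha₀ hT₀ (n : ↥(unitaryGroupOfForm (conjLocal L (IsCMField.complexConj L) v) (cmLocalForm L 3 v)))) := by
  haveI : Algebra.IsQuadraticExtension ↥(maximalRealSubfield L) L := IsCMField.isQuadraticExtension L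
  have hcoe : ∀ g : ↥(unitaryGroupOfForm (conjLocal L (IsCMField.complexConj L) v) (cmLocalForm L 3 v)),
      (((eG (cmDatumLocalCongr L v T₀ ha₀ hT₀ g) : ↥(unitaryGroupOfForm (galAdicCompletionMap (L := L) (IsCMField.complexConj L) hw)
          ((StdForm.antidiagonal 3).over (w.1.adicCompletion L)))) : GL (Fin 3) (w.1.adicCompletion L)) : Matrix (Fin 3) (Fin 3) (w.1.adicCompletion L)) =
        (((localNonsplitEquiv (IsCMField.complexConj L) (Matrix.of fun i j : Fin 3 => if i.val + j.val + 1 = 3 then (1 : L) else 0)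
            (IsCMField.complexConj_ne_one L) w hw g).val : GL (Fin 3) (w.1.adicCompletion L)) : Matrix (Fin 3) (Fin 3) (w.1.adicCompletion L)) :=
    fun g => congrArg (fun x : GL (Fin 3) (w.1.adicCompletion L) => (x : Matrix (Fin 3) (Fin 3) (w.1.adicCompletion L))) (hmat g)
  have hN : ∀ g : ↥(unitaryGroupOfForm (conjLocal L (IsCMField.complexConj L) v) (cmLocalForm L 3 v)),
      g ∈ unipotentU (conjLocal L (IsCMField.complexConj L) v) (cmLocalForm L 3 v) ↔
        ((cmDatumLocalCongr L v T₀ ha₀ hT₀).trans eG) g ∈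
          unipotentU (galAdicCompletionMap (L := L) (IsCMField.complexConj L) hw) ((StdForm.antidiagonal 3).over (w.1.adicCompletion L)) := by
    intro g
    refine (localNonsplitEquiv_mem_unipotentU_iff L v w hw g).symm.trans ?_
    rw [mem_unipotentU_iff, mem_unipotentU_iff, ContinuousMulEquiv.trans_apply, hcoe g]
  exact ⟨fun g => (hN g).trans (by rw [ContinuousMulEquiv.trans_apply]), ContinuousMulEquiv.restrictSubgroup _ _ _ hN, fun n => rfl⟩

end GFrame

/-! ## §3 The unit normalisation `hνG1` from the socket's `νG (U(H′)(𝒪_v)) = 1` -/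

section Normalisation

/-- **The level set identity behind `hνG1`.**  If the stub frame matches levels ((LEV) of `exists_socketFrame_three`) and `K₃` is the hyperspecial level of `U(Φ₃)(L⁺_v)` (`hKv`,
the (B2a) letter), then `congr.symm ⁻¹' K₃ = U(H′)(𝒪_v)` as SETS. [cite: Rogawski1990, §4.3 p. 43; §14.2 p. 233] -/
theorem preimage_congr_symm_level_eq {H' : Matrix (Fin 3) (Fin 3) L} {v : HeightOneSpectrum (𝓞 ↥(maximalRealSubfield L))}
    (T₀ : GL (Fin 3) (LocalRing L v)) {a₀ : LocalRing L v} (ha₀ : IsUnit a₀)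
    (hT₀ : formCongr (conjLocal L (IsCMField.complexConj L) v) T₀ (H'.map (algebraMap L (LocalRing L v))) =
      a₀ • (Matrix.of fun i j : Fin 3 => if i.val + j.val + 1 = 3 then (1 : L) else 0).map (algebraMap L (LocalRing L v)))
    (hlev : ∀ g : (cmDatum L 3 H').Local v,
      (cmDatumLocalCongr L v T₀ ha₀ hT₀).symm g ∈
          cmLocalIntegralLevel L 3 (Matrix.of fun i j : Fin 3 => if i.val + j.val + 1 = 3 then (1 : L) else 0) v ↔
        g ∈ cmLocalIntegralLevel L 3 H' v)
    {K : Subgroup ↥(unitaryGroupOfForm (conjLocal L (IsCMField.complexConj L) v) (cmLocalForm L 3 v))}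
    (hKv : ∀ g : ↥(unitaryGroupOfForm (conjLocal L (IsCMField.complexConj L) v) (cmLocalForm L 3 v)),
      g ∈ K ↔ g ∈ cmLocalIntegralLevel L 3 (Matrix.of fun i j : Fin 3 => if i.val + j.val + 1 = 3 then (1 : L) else 0) v) :
    (cmDatumLocalCongr L v T₀ ha₀ hT₀).symm ⁻¹' (K : Set ↥(unitaryGroupOfForm (conjLocal L (IsCMField.complexConj L) v) (cmLocalForm L 3 v))) =
      (cmLocalIntegralLevel L 3 H' v : Set ((cmDatum L 3 H').Local v)) := by
  -- both memberships read in ONE carrier (`(cmDatum L 3 Φ₃).Local v` IS `↥(U(c ⊗ 1, (Φ₃)_v))`, ★ `cmDatum_Local_eq` `rfl`)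
  have hKv' : ∀ x : (cmDatum L 3 (Matrix.of fun i j : Fin 3 => if i.val + j.val + 1 = 3 then (1 : L) else 0)).Local v,
      x ∈ (K : Set ↥(unitaryGroupOfForm (conjLocal L (IsCMField.complexConj L) v) (cmLocalForm L 3 v))) ↔
        x ∈ cmLocalIntegralLevel L 3 (Matrix.of fun i j : Fin 3 => if i.val + j.val + 1 = 3 then (1 : L) else 0) v := hKv
  ext g
  exact Set.mem_preimage.trans (((hKv' _).trans (hlev g)).trans SetLike.mem_coe.symm)

/-- **`hνG1` OF THE ★ (B2d) PAYER FROM THE SOCKET'S NORMALISATION** `νG (U(H′)(𝒪_v)) = 1` (binder :1008–:1009 of `StubR90ExtE1HeckeFLOneFrame`): with a level-matching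
stub frame, `νG (congr.symm ⁻¹' K₃) = 1`. [cite: Rogawski1990, §4.3 p. 43; §14.2 p. 233] -/
theorem measure_preimage_congr_symm_eq_one {H' : Matrix (Fin 3) (Fin 3) L} {v : HeightOneSpectrum (𝓞 ↥(maximalRealSubfield L))}
    [MeasurableSpace ((cmDatum L 3 H').Local v)]
    (T₀ : GL (Fin 3) (LocalRing L v)) {a₀ : LocalRing L v} (ha₀ : IsUnit a₀)
    (hT₀ : formCongr (conjLocal L (IsCMField.complexConj L) v) T₀ (H'.map (algebraMap L (LocalRing L v))) =
      a₀ • (Matrix.of fun i j : Fin 3 => if i.val + j.val + 1 = 3 then (1 : L) else 0).map (algebraMap L (LocalRing L v)))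
    (hlev : ∀ g : (cmDatum L 3 H').Local v,
      (cmDatumLocalCongr L v T₀ ha₀ hT₀).symm g ∈
          cmLocalIntegralLevel L 3 (Matrix.of fun i j : Fin 3 => if i.val + j.val + 1 = 3 then (1 : L) else 0) v ↔
        g ∈ cmLocalIntegralLevel L 3 H' v)
    {K : Subgroup ↥(unitaryGroupOfForm (conjLocal L (IsCMField.complexConj L) v) (cmLocalForm L 3 v))}
    (hKv : ∀ g : ↥(unitaryGroupOfForm (conjLocal L (IsCMField.complexConj L) v) (cmLocalForm L 3 v)),
      g ∈ K ↔ g ∈ cmLocalIntegralLevel L 3 (Matrix.of fun i j : Fin 3 => if i.val + j.val + 1 = 3 then (1 : L) else 0) v)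
    (νG : Measure ((cmDatum L 3 H').Local v))
    (hνG : νG (cmLocalIntegralLevel L 3 H' v : Set ((cmDatum L 3 H').Local v)) = 1) :
    νG ((cmDatumLocalCongr L v T₀ ha₀ hT₀).symm ⁻¹' (K : Set ↥(unitaryGroupOfForm (conjLocal L (IsCMField.complexConj L) v) (cmLocalForm L 3 v)))) = 1 := by
  rw [preimage_congr_symm_level_eq L T₀ ha₀ hT₀ hlev hKv, hνG]

end Normalisation

/-! ## §4 The torus entry law `hEt` on the Levi stratum through the matrix law -/

section TorusEntry

/-- **TORUS ENTRY LAW `hEt` OF THE ★ (B2d) PAYER.**  For a frame with the matrix law (MAT) `(eG (congr g))_w = g_w` and `γ_H = (diag(d′₀, d′₁), u)` on the Levi stratum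
(`hd'`), the framed element `eG (congr (ι_v γ_H))` is the DIAGONAL matrix `diag(d′₀,w, u_w, d′₁,w)` of `w`-components (★ `endoEmbLocal_eq_glDiagonal_of_fst_eq`: `ι_v γ_H =
diag(d′₀, u, d′₁)`; the one-place model reads matrices entrywise at `w`, ★ `coe_coe_localNonsplitEquiv_apply`). [cite: Rogawski1990, §4.9 p. 55; §4.8 p. 53] -/
theorem coe_frame_congr_endoEmbLocal_eq_diagonal {H' : Matrix (Fin 3) (Fin 3) L} {v : HeightOneSpectrum (𝓞 ↥(maximalRealSubfield L))}
    (w : PlacesOver L v) (hw : IsCMField.complexConj L • w.1 = w.1)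
    (T₀ : GL (Fin 3) (LocalRing L v)) {a₀ : LocalRing L v} (ha₀ : IsUnit a₀)
    (hT₀ : formCongr (conjLocal L (IsCMField.complexConj L) v) T₀ (H'.map (algebraMap L (LocalRing L v))) =
      a₀ • (Matrix.of fun i j : Fin 3 => if i.val + j.val + 1 = 3 then (1 : L) else 0).map (algebraMap L (LocalRing L v)))
    (eG : (cmDatum L 3 H').Local v ≃ₜ*
      ↥(unitaryGroupOfForm (galAdicCompletionMap (L := L) (IsCMField.complexConj L) hw) ((StdForm.antidiagonal 3).over (w.1.adicCompletion L))))
    (hmat : ∀ g : ↥(unitaryGroupOfForm (conjLocal L (IsCMField.complexConj L) v) (cmLocalForm L 3 v)),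
      ((eG (cmDatumLocalCongr L v T₀ ha₀ hT₀ g) :
          ↥(unitaryGroupOfForm (galAdicCompletionMap (L := L) (IsCMField.complexConj L) hw) ((StdForm.antidiagonal 3).over (w.1.adicCompletion L)))) :
            GL (Fin 3) (w.1.adicCompletion L)) =
        ((localNonsplitEquiv (IsCMField.complexConj L) (Matrix.of fun i j : Fin 3 => if i.val + j.val + 1 = 3 then (1 : L) else 0)
            (IsCMField.complexConj_ne_one L) w hw g).val : GL (Fin 3) (w.1.adicCompletion L)))
    {γH : ((cmDatum L 2 (Matrix.of fun i j : Fin 2 => if i.val + j.val + 1 = 2 then (1 : L) else 0)).Local v ×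
      (cmDatum L 1 (Matrix.of fun i j : Fin 1 => if i.val + j.val + 1 = 1 then (1 : L) else 0)).Local v)}
    {d' : Fin 2 → (UnitaryGroup.LocalRing L v)ˣ} (hd' : glDiagonal 2 (UnitaryGroup.LocalRing L v) d' = (γH.1.val : GL (Fin 2) (UnitaryGroup.LocalRing L v))) :
    (((eG (cmDatumLocalCongr L v T₀ ha₀ hT₀ (endoEmbLocal L v γH)) :
        ↥(unitaryGroupOfForm (galAdicCompletionMap (L := L) (IsCMField.complexConj L) hw) ((StdForm.antidiagonal 3).over (w.1.adicCompletion L)))) :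
          GL (Fin 3) (w.1.adicCompletion L)) : Matrix (Fin 3) (Fin 3) (w.1.adicCompletion L)) =
      Matrix.diagonal ![(d' 0 : UnitaryGroup.LocalRing L v) w, finGammaTwo L v γH w, (d' 1 : UnitaryGroup.LocalRing L v) w] := by
  rw [hmat, coe_coe_localNonsplitEquiv_apply, endoEmbLocal_eq_glDiagonal_of_fst_eq L v γH hd', coe_glDiagonal,
    Matrix.diagonal_map (map_zero _)]
  congr 1
  funext i
  fin_cases i
  · rfl
  · simp only [Fin.mk_one, Fin.isValue, Matrix.cons_val_one, Matrix.cons_val_zero, Pi.evalRingHom_apply]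
    rw [(isUnit_finGammaTwo L v γH).unit_spec]
  · rfl

end TorusEntry

/-! ## §5 «FRAME RECIPE», `H`-side: the LITERAL one-place frame `e₀²` at `N = 2` with its letters -/

section HFrame

/-- **(G4) THE LITERAL `H`-FRAME AT `N = 2`.**  At a non-split place: the one-place frame `e₀² : U(Φ₂)(L⁺_v) ≃ₜ* U(σ_w, J₀)(L_w)` (`J₀ = antidiag(1,1)`) of ★ W9-A′ (F.2)
with (MAT₂) `(e₀² g)_w = g_w` and (hEK₂) `e₀² g ∈ U(J₀)(𝒪_w) ↔ g ∈ U(Φ₂)(𝒪_v)` — the socket's K-law₂ (:1049–:1051) token for token, so `e₀²` inhabits the adversarial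
`∀ eH, (K-law₂) → …`; the radical letters and the torus entry law follow from (MAT₂) (`unipotent_law_two_of_matrixLaw`, `coe_frame_two_eq_diagonal`).
[cite: Rogawski1990, §4.9 p. 55] [cite: PlatonovRapinchuk1994, §5.1] -/
theorem exists_socketFrame_two {v : HeightOneSpectrum (𝓞 ↥(maximalRealSubfield L))} (w : PlacesOver L v) (hw : IsCMField.complexConj L • w.1 = w.1) :
    ∃ eH : (cmDatum L 2 (Matrix.of fun i j : Fin 2 => if i.val + j.val + 1 = 2 then (1 : L) else 0)).Local v ≃ₜ*
        ↥(unitaryGroupOfForm (galAdicCompletionMap (L := L) (IsCMField.complexConj L) hw) ((StdForm.antidiagonal 2).over (w.1.adicCompletion L))),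
      -- (MAT₂)
      (∀ g, ((eH g : ↥(unitaryGroupOfForm (galAdicCompletionMap (L := L) (IsCMField.complexConj L) hw) ((StdForm.antidiagonal 2).over (w.1.adicCompletion L)))) :
          GL (Fin 2) (w.1.adicCompletion L)) =
        ((localNonsplitEquiv (IsCMField.complexConj L) (Matrix.of fun i j : Fin 2 => if i.val + j.val + 1 = 2 then (1 : L) else 0)
            (IsCMField.complexConj_ne_one L) w hw g).val : GL (Fin 2) (w.1.adicCompletion L))) ∧
      -- (hEK₂) = the socket's K-law₂
      (∀ g : (cmDatum L 2 (Matrix.of fun i j : Fin 2 => if i.val + j.val + 1 = 2 then (1 : L) else 0)).Local v,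
        eH g ∈ unitaryInt (galAdicCompletionMap (L := L) (IsCMField.complexConj L) hw) ((StdForm.antidiagonal 2).over (w.1.adicCompletion L)) ↔
          g ∈ cmLocalIntegralLevel L 2 (Matrix.of fun i j : Fin 2 => if i.val + j.val + 1 = 2 then (1 : L) else 0) v) :=
  exists_continuousMulEquiv_memLaw_unitaryInt_cm_antidiagOne L 2 w hw

/-- **THE RADICAL LETTERS `hN₂`, `EN₂`, `hEN₂` OF THE ★ (B2d) PAYER FROM THE MATRIX LAW (MAT₂)**: for any `H`-frame `eH` with `(eH g)_w = g_w`,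
`g ∈ N(Φ₂)(L⁺_v) = (cmBorelTriple L 2 v).N ↔ eH g ∈ N(J₀)(L_w)` (★ `localNonsplitEquiv_mem_unipotentU_iff₂` + ★ `mem_unipotentU_iff`) and the radical transport `EN₂` with
`↑(EN₂ n) = eH n`. [cite: Rogawski1990, §1.10 p. 9; §4.9 p. 55] [cite: PlatonovRapinchuk1994, §5.1] -/
theorem unipotent_law_two_of_matrixLaw {v : HeightOneSpectrum (𝓞 ↥(maximalRealSubfield L))} (w : PlacesOver L v) (hw : IsCMField.complexConj L • w.1 = w.1)
    (eH : (cmDatum L 2 (Matrix.of fun i j : Fin 2 => if i.val + j.val + 1 = 2 then (1 : L) else 0)).Local v ≃ₜ*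
      ↥(unitaryGroupOfForm (galAdicCompletionMap (L := L) (IsCMField.complexConj L) hw) ((StdForm.antidiagonal 2).over (w.1.adicCompletion L))))
    (hmat : ∀ g, ((eH g : ↥(unitaryGroupOfForm (galAdicCompletionMap (L := L) (IsCMField.complexConj L) hw) ((StdForm.antidiagonal 2).over (w.1.adicCompletion L)))) :
        GL (Fin 2) (w.1.adicCompletion L)) =
      ((localNonsplitEquiv (IsCMField.complexConj L) (Matrix.of fun i j : Fin 2 => if i.val + j.val + 1 = 2 then (1 : L) else 0)
          (IsCMField.complexConj_ne_one L) w hw g).val : GL (Fin 2) (w.1.adicCompletion L))) :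
    (∀ g : ↥(unitaryGroupOfForm (conjLocal L (IsCMField.complexConj L) v) (cmLocalForm L 2 v)), g ∈ (cmBorelTriple L 2 v).N ↔
        eH g ∈ unipotentU (galAdicCompletionMap (L := L) (IsCMField.complexConj L) hw) ((StdForm.antidiagonal 2).over (w.1.adicCompletion L))) ∧
      ∃ EN₂ : ↥(cmBorelTriple L 2 v).N ≃ₜ* ↥(unipotentU (galAdicCompletionMap (L := L) (IsCMField.complexConj L) hw) ((StdForm.antidiagonal 2).over (w.1.adicCompletion L))),
        ∀ n : ↥(cmBorelTriple L 2 v).N,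
          ((EN₂ n : ↥(unipotentU (galAdicCompletionMap (L := L) (IsCMField.complexConj L) hw) ((StdForm.antidiagonal 2).over (w.1.adicCompletion L)))) :
              ↥(unitaryGroupOfForm (galAdicCompletionMap (L := L) (IsCMField.complexConj L) hw) ((StdForm.antidiagonal 2).over (w.1.adicCompletion L)))) =
            eH (n : ↥(unitaryGroupOfForm (conjLocal L (IsCMField.complexConj L) v) (cmLocalForm L 2 v))) := by
  haveI : Algebra.IsQuadraticExtension ↥(maximalRealSubfield L) L := IsCMField.isQuadraticExtension L
  have hcoe : ∀ g : ↥(unitaryGroupOfForm (conjLocal L (IsCMField.complexConj L) v) (cmLocalForm L 2 v)),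
      (((eH g : ↥(unitaryGroupOfForm (galAdicCompletionMap (L := L) (IsCMField.complexConj L) hw)
          ((StdForm.antidiagonal 2).over (w.1.adicCompletion L)))) : GL (Fin 2) (w.1.adicCompletion L)) : Matrix (Fin 2) (Fin 2) (w.1.adicCompletion L)) =
        (((localNonsplitEquiv (IsCMField.complexConj L) (Matrix.of fun i j : Fin 2 => if i.val + j.val + 1 = 2 then (1 : L) else 0)
            (IsCMField.complexConj_ne_one L) w hw g).val : GL (Fin 2) (w.1.adicCompletion L)) : Matrix (Fin 2) (Fin 2) (w.1.adicCompletion L)) :=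
    fun g => congrArg (fun x : GL (Fin 2) (w.1.adicCompletion L) => (x : Matrix (Fin 2) (Fin 2) (w.1.adicCompletion L))) (hmat g)
  have hN : ∀ g : ↥(unitaryGroupOfForm (conjLocal L (IsCMField.complexConj L) v) (cmLocalForm L 2 v)), g ∈ (cmBorelTriple L 2 v).N ↔
      eH g ∈ unipotentU (galAdicCompletionMap (L := L) (IsCMField.complexConj L) hw) ((StdForm.antidiagonal 2).over (w.1.adicCompletion L)) := by
    intro g
    refine (Summit.HodgeConjecture.HodgeConjecture.Cruxes.H413.F0P3cCMLocalNonsplitBorelTransportU2.localNonsplitEquiv_mem_unipotentU_iff₂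
      L v w hw g).symm.trans ?_
    rw [mem_unipotentU_iff, mem_unipotentU_iff, hcoe g]
  exact ⟨hN, ContinuousMulEquiv.restrictSubgroup _ _ _ hN, fun n => rfl⟩

/-- **TORUS ENTRY LAW `hEHt` OF THE ★ (B2d) PAYER** for an `H`-frame with the matrix law (MAT₂): for `γ_H.1 = diag(d′₀, d′₁)` (`hd'`), `(eH γ_H.1)_w = diag(d′₀,w, d′₁,w)`.
[cite: Rogawski1990, §4.9 p. 55] [cite: PlatonovRapinchuk1994, §5.1] -/
theorem coe_frame_two_eq_diagonal {v : HeightOneSpectrum (𝓞 ↥(maximalRealSubfield L))} (w : PlacesOver L v) (hw : IsCMField.complexConj L • w.1 = w.1)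
    (eH : (cmDatum L 2 (Matrix.of fun i j : Fin 2 => if i.val + j.val + 1 = 2 then (1 : L) else 0)).Local v ≃ₜ*
      ↥(unitaryGroupOfForm (galAdicCompletionMap (L := L) (IsCMField.complexConj L) hw) ((StdForm.antidiagonal 2).over (w.1.adicCompletion L))))
    (hmat : ∀ g, ((eH g : ↥(unitaryGroupOfForm (galAdicCompletionMap (L := L) (IsCMField.complexConj L) hw) ((StdForm.antidiagonal 2).over (w.1.adicCompletion L)))) :
        GL (Fin 2) (w.1.adicCompletion L)) =
      ((localNonsplitEquiv (IsCMField.complexConj L) (Matrix.of fun i j : Fin 2 => if i.val + j.val + 1 = 2 then (1 : L) else 0)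
          (IsCMField.complexConj_ne_one L) w hw g).val : GL (Fin 2) (w.1.adicCompletion L)))
    {γH : ((cmDatum L 2 (Matrix.of fun i j : Fin 2 => if i.val + j.val + 1 = 2 then (1 : L) else 0)).Local v ×
      (cmDatum L 1 (Matrix.of fun i j : Fin 1 => if i.val + j.val + 1 = 1 then (1 : L) else 0)).Local v)}
    {d' : Fin 2 → (UnitaryGroup.LocalRing L v)ˣ} (hd' : glDiagonal 2 (UnitaryGroup.LocalRing L v) d' = (γH.1.val : GL (Fin 2) (UnitaryGroup.LocalRing L v))) :
    (((eH γH.1 : ↥(unitaryGroupOfForm (galAdicCompletionMap (L := L) (IsCMField.complexConj L) hw) ((StdForm.antidiagonal 2).over (w.1.adicCompletion L)))) :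
        GL (Fin 2) (w.1.adicCompletion L)) : Matrix (Fin 2) (Fin 2) (w.1.adicCompletion L)) =
      Matrix.diagonal ![(d' 0 : UnitaryGroup.LocalRing L v) w, (d' 1 : UnitaryGroup.LocalRing L v) w] := by
  rw [hmat, coe_coe_localNonsplitEquiv_apply, ← hd', coe_glDiagonal, Matrix.diagonal_map (map_zero _)]
  congr 1
  funext i
  fin_cases i <;> rfl

end HFrame

/-! ## §6 «EH-SWAP»: the socket's `H`-test function does not see WHICH K-law₂ frame is used -/

section EHSwap

/-- **«EH-SWAP» IN SOCKET LETTERS.**  At an inert unramified place, for ANY two `H`-frames `eH eH' : U(Φ₂)(L⁺_v) ≃ₜ* U(σ_w, J₀)(L_w)` with the K-law₂ and every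
`φ^H ∈ ℋ(U(J₀)(L_w), K₀)`, the socket's `H`-side test function `h ↦ (T₂[K₀] φ^H).coeff ↑(eH h.1)` on `H_v = U(Φ₂)_v × U(Φ₁)_v` (= `Lines` D's
`fun h => heckeToFun K₀ φH (eH h.1)`, :223 by `rfl`) is THE SAME FUNCTION for `eH` and `eH'` (★ W9-A.6 `coeff_toVector_comp_eq_of_memLaw_cm_two`, composed with `Prod.fst`).
Hence the (G5) assembler replaces the adversarial `eH` by the literal `e₀²` of `exists_socketFrame_two` before applying any cell payer.
[cite: Rogawski1990, §4.9 p. 55; §4.10 Prop. 4.10.1] [cite: CartierCorvallis1979, §IV.1] -/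
theorem heckeTestFun_eq_of_memLaw_two {v : HeightOneSpectrum (𝓞 ↥(maximalRealSubfield L))} (w : PlacesOver L v)
    (hw : IsCMField.complexConj L • w.1 = w.1) (hv : Algebra.IsUnramifiedIn (𝓞 L) v.asIdeal)
    (eH eH' : (cmDatum L 2 (Matrix.of fun i j : Fin 2 => if i.val + j.val + 1 = 2 then (1 : L) else 0)).Local v ≃ₜ*
      ↥(unitaryGroupOfForm (galAdicCompletionMap (L := L) (IsCMField.complexConj L) hw) ((StdForm.antidiagonal 2).over (w.1.adicCompletion L))))
    (heH : ∀ h : (cmDatum L 2 (Matrix.of fun i j : Fin 2 => if i.val + j.val + 1 = 2 then (1 : L) else 0)).Local v,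
      eH h ∈ unitaryInt (galAdicCompletionMap (L := L) (IsCMField.complexConj L) hw) ((StdForm.antidiagonal 2).over (w.1.adicCompletion L)) ↔
        h ∈ cmLocalIntegralLevel L 2 (Matrix.of fun i j : Fin 2 => if i.val + j.val + 1 = 2 then (1 : L) else 0) v)
    (heH' : ∀ h : (cmDatum L 2 (Matrix.of fun i j : Fin 2 => if i.val + j.val + 1 = 2 then (1 : L) else 0)).Local v,
      eH' h ∈ unitaryInt (galAdicCompletionMap (L := L) (IsCMField.complexConj L) hw) ((StdForm.antidiagonal 2).over (w.1.adicCompletion L)) ↔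
        h ∈ cmLocalIntegralLevel L 2 (Matrix.of fun i j : Fin 2 => if i.val + j.val + 1 = 2 then (1 : L) else 0) v)
    (φH : heckeAlgebra ℂ ↥(unitaryGroupOfForm (galAdicCompletionMap (L := L) (IsCMField.complexConj L) hw) ((StdForm.antidiagonal 2).over (w.1.adicCompletion L)))
      (unitaryInt (galAdicCompletionMap (L := L) (IsCMField.complexConj L) hw) ((StdForm.antidiagonal 2).over (w.1.adicCompletion L)))) :
    (fun h : (cmDatum L 2 (Matrix.of fun i j : Fin 2 => if i.val + j.val + 1 = 2 then (1 : L) else 0)).Local v ×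
        (cmDatum L 1 (Matrix.of fun i j : Fin 1 => if i.val + j.val + 1 = 1 then (1 : L) else 0)).Local v =>
      (heckeAlgebra.toVector (unitaryInt (galAdicCompletionMap (L := L) (IsCMField.complexConj L) hw) ((StdForm.antidiagonal 2).over (w.1.adicCompletion L))) φH).coeff
        ((eH h.1 : ↥(unitaryGroupOfForm (galAdicCompletionMap (L := L) (IsCMField.complexConj L) hw) ((StdForm.antidiagonal 2).over (w.1.adicCompletion L)))) :
          ↥(unitaryGroupOfForm (galAdicCompletionMap (L := L) (IsCMField.complexConj L) hw) ((StdForm.antidiagonal 2).over (w.1.adicCompletion L))) ⧸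
            unitaryInt (galAdicCompletionMap (L := L) (IsCMField.complexConj L) hw) ((StdForm.antidiagonal 2).over (w.1.adicCompletion L)))) =
    fun h =>
      (heckeAlgebra.toVector (unitaryInt (galAdicCompletionMap (L := L) (IsCMField.complexConj L) hw) ((StdForm.antidiagonal 2).over (w.1.adicCompletion L))) φH).coeff
        ((eH' h.1 : ↥(unitaryGroupOfForm (galAdicCompletionMap (L := L) (IsCMField.complexConj L) hw) ((StdForm.antidiagonal 2).over (w.1.adicCompletion L)))) :
          ↥(unitaryGroupOfForm (galAdicCompletionMap (L := L) (IsCMField.complexConj L) hw) ((StdForm.antidiagonal 2).over (w.1.adicCompletion L))) ⧸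
            unitaryInt (galAdicCompletionMap (L := L) (IsCMField.complexConj L) hw) ((StdForm.antidiagonal 2).over (w.1.adicCompletion L))) := by
  funext h
  exact congrFun (coeff_toVector_comp_eq_of_memLaw_cm_two L w hw hv
    (cmLocalIntegralLevel L 2 (Matrix.of fun i j : Fin 2 => if i.val + j.val + 1 = 2 then (1 : L) else 0) v) eH' eH heH' heH φH) h.1

end EHSwap

end Summit.HodgeConjecture.HodgeConjecture.R90.S6

end
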